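import Mathlib
import HarnessLib
import Literature.Combinatorics.Additive.KempermanStructureTheoremNecessity

/-!
# Grynkiewicz 2009, §6 Claim 5, case `l = 4`: «Suppose we have type (I)» — the structure it forces

[cite: Grynkiewicz2009, §6 Claim 5 (proof of Thm 4.1, p. 26, case l = 4, type (I))] [tag: critical-pair]
[tag: inverse-theorem]

Topic `Literature/Combinatorics/Additive`.  Cell `mm-stpp` (D-0046), seat `mm-stpp-lit` (gen 24); the
port of D. J. Grynkiewicz, *A step beyond Kemperman's structure theorem*, Mathematika **55** (2009)
67–114 continued.  §6 Claim 5, case `l = 4`, the type (I) paragraph (print p. 26) up to «Since `L = K`»,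
as REUSABLE KST API in the style of `KempermanTypeTwoFourPairs.lean` / `KempermanTypeFourFourPairs.lean`:
a Kemperman decomposition (Kemperman's form, quasi-period `L`) of a pair `(A, B)` with `A + B` aperiodic
and the (42)-data of the `l = 4` frame — `x, x + d ∈ A`, `y, y + d ∈ B`, `d ≠ 0`, `2d = 0`, every
representation `u + v` (`u ∈ A`, `v ∈ B`) of `x + y` or of `x + y + d` has `u ∈ {x, x + d}` and
`v ∈ {y, y + d}` — whose bottom pair is of type (I) has: `L = {0, d}` (the print's `L = K`),
`|A₀| = |B₀| = 1`, and all four of `x, x + d, y, y + d` in the periodic parts.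

SOURCE (print p. 26, p0026 L9–L21 of the held text): «Suppose we have type (I) with w.l.o.g.
`|φ_H(A₀′)| = 1`.  Hence some `aᵢ`, say `a₂`, is contained in `A₁′`.  Thus, if some `bᵢ` is contained in
`B₀′`, then it follows in view of (42) that either `|φ_H(B₀′)| = 2`, `φ_L(a₁) = φ_L(a₂)` and `b₁, b₂ ∈ B₀′`
(if `|φ_H(B₀′)| ≥ 2`), or else w.l.o.g. `φ_H(B₀′) = {φ_H(b₂)}` and `φ_H(A₀′) = {φ_H(a₁)}` (if
`|φ_H(B₀′)| = 1`).  In the former case `φ_H(B₀′)`, and thus `φ_H(B)`, is `K/H`-periodic, contradicting that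
`φ_H(A + B)` is aperiodic.  In the later case, `φ_H(a₁) + φ_H(b₂) = φ_H(a₂) + φ_H(b₁)` contradicts that
`φ_H(A₀′) + φ_H(B₀′) = φ_H(a₁) + φ_H(b₂)` is a unique expression element.  Therefore we can assume
`b₁, b₂ ∈ B₁′`.  Thus, since `a₂ ∈ A₁′`, it follows in view of (42) that `φ_L(a₁) = φ_L(a₂)`,
`φ_L(b₁) = φ_L(b₂)`, and `|L/H| = 2`.  Since `φ_L(a₁) = φ_L(a₂)`, it follows that `K/H ≤ L/H`.  Hence
`|L/H| = 2` implies that `L = K`.  Since `|L/H| = 2`, and since `φ_H(A + B)` is aperiodic, it follows that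
`|φ_H(A₀′)| = |φ_H(B₀′)| = 1`.»  (The remainder — «applying KST modulo `L = K` … type (II) … Thus the
theorem holds with type (VIII)» — is the type (VIII) construction, a separate file.)

THIS FILE (stated in the quotient `G/H` of the print, renamed `G`; `φ_H` dropped; `K/H = {0, d}`).
* `IsKempermanDecompI.isPeriodic_add_of_bottom_subset_pair` — «`φ_H(B₀′)`, and thus `φ_H(B)`, is
  `K/H`-periodic»: if `d ∈ L` and `B₀ ⊆ {v, v + d}` with `v, v + d ∈ B`, then `A + B` is periodic.
* `IsKempermanDecompI.notMem_bottom_of_twoReps` — «Therefore we can assume `b₁, b₂ ∈ B₁′`»: with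
  `a ∈ A₁`, `a + d ∈ A` and the (42)-data for `a + v₀`, the element `v₀` is not in `B₀` (the print's two
  cases; in the case `v₀ + d ∉ B₀` the print's «w.l.o.g. `φ_H(A₀′) = {φ_H(a₁)}`» is made explicit:
  `a + d ∈ A₁` would force `d ∈ L` and `v₀ ∈ B₁`, so `a + d ∈ A₀`, and then condition (i) for the pair
  `(a, v₀ + d)` is the contradiction; `|A₀| = 1` is not used here).
* `IsKempermanDecompI.mem_iff_of_twoReps` — «`|L/H| = 2` … `L = K`»: `a ∈ A₁`, `v ∈ B₁` and the
  (42)-data for `a + v` give `L = {0, d}`.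
* `IsKempermanDecompI.structure_of_isElementaryI_of_twoReps` — the paragraph's conclusion:
  `A₀ = {a₀}`, `B₀ = {b₀}`, `L = {0, d}`, `x, x + d ∈ A₁`, `y, y + d ∈ B₁` (both cases `|A₀| = 1`,
  `|B₀| = 1` of type (I), by the symmetry `A ↔ B`).

MAIN RESULTS (0 definitions, 0 named facts; everything PROVED): the four theorems above.

## References
* D. J. Grynkiewicz, *A step beyond Kemperman's structure theorem*, Mathematika 55 (2009) 67–114,
  doi:10.1112/S0025579300000966, §6 Claim 5 (p. 26), display (42); §2 (type (I))
  [cite: Grynkiewicz2009, Thm 4.1 (proof, Claim 5)] — held `paper:doi-10-1112-s0025579300000966`,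
  p0026 read 2026-08-29.
-/

namespace Literature.Combinatorics.Additive

open Finset
open scoped Pointwise

universe u

variable {G : Type u} [AddCommGroup G] [DecidableEq G]

namespace IsKempermanDecompI

variable {L : AddSubgroup G} {A B A₁ A₀ B₁ B₀ : Finset G}

/-- **«`φ_H(B₀′)`, and thus `φ_H(B)`, is `K/H`-periodic, contradicting that `φ_H(A + B)` is aperiodic.»**
If `d ∈ L` (`d ≠ 0`, `2d = 0`) and the bottom `B₀ ⊆ {v, v + d}` with `v, v + d ∈ B`, then `d + B = B`
(`B₁` is `L`-periodic), so `A + B` is periodic. [cite: Grynkiewicz2009, §6 Claim 5 (p. 26, type (I),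
«In the former case …»)] -/
theorem isPeriodic_add_of_bottom_subset_pair (h : IsKempermanDecompI L A B A₁ A₀ B₁ B₀) {v d : G}
    (hdL : d ∈ L) (hd : d ≠ 0) (h2d : d + d = 0) (hv : v ∈ B) (hvd : v + d ∈ B)
    (hB₀ : ∀ b ∈ B₀, b = v ∨ b = v + d) : IsPeriodic (A + B) := by
  have hsub : d +ᵥ B ⊆ B := by
    intro z hz
    obtain ⟨b, hb, rfl⟩ := mem_vadd_finset.1 hz
    have hbB : b ∈ B₁ ∪ B₀ := by rw [h.decomp_right.union_eq]; exact hb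
    rcases mem_union.1 hbB with hb₁ | hb₀
    · exact h.decomp_right.left_subset (h.decomp_right.periodic.add_mem hdL hb₁)
    · rcases hB₀ b hb₀ with rfl | rfl
      · rw [vadd_eq_add, add_comm]; exact hvd
      · rw [vadd_eq_add, show d + (v + d) = v + (d + d) by abel, h2d, add_zero]; exact hv
  have heq : d +ᵥ B = B := eq_of_subset_of_card_le hsub (by rw [card_vadd_finset])
  refine ⟨AddSubgroup.zmultiples d, ?_, (isPeriodicWith_zmultiples_of_vadd_eq heq).add_left A⟩
  rw [Ne, AddSubgroup.zmultiples_eq_bot]; exact hd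

/-- **«Therefore we can assume `b₁, b₂ ∈ B₁′`.»**  Let `a ∈ A₁` with `a + d ∈ A` (`d ≠ 0`,
`2d = 0`), `v₀, v₀ + d ∈ B`, `A + B` aperiodic, and suppose `a + v₀` has
exactly the two representations `(a, v₀)`, `(a + d, v₀ + d)` in `A + B` (display (42)).  Then
`v₀ ∉ B₀`.  For if `v₀ ∈ B₀`: every `b' ∈ B₀` gives the representation `(a + (v₀ − b')) + b'`, so
`B₀ ⊆ {v₀, v₀ + d}`; if `v₀ + d ∈ B₀` then `d ∈ L` and `B` is `{0, d}`-periodic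
(`isPeriodic_add_of_bottom_subset_pair`); if `B₀ = {v₀}` then `v₀ + d ∈ B₁`, and the representation
`(a + d, v₀ + d)` has `a + d ∈ A₀` (were `a + d ∈ A₁`, all `(a + d + l) + (v₀ + d − l)`, `l ∈ L`, would
represent `a + v₀`, forcing `d ∈ L` and `v₀ = (v₀ + d) − d ∈ B₁`), and condition (i) applied to
`a + (v₀ + d) ≡ (a + d) + v₀` gives `d ∈ L`, `v₀ ∈ B₁` again — a contradiction.  (The print's
«w.l.o.g. `|φ_H(A₀′)| = 1`» is not needed for this step.)
[cite: Grynkiewicz2009, §6 Claim 5 (p. 26, type (I), «Thus, if some bᵢ is contained in B₀′ …»)] -/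
theorem notMem_bottom_of_twoReps (h : IsKempermanDecompI L A B A₁ A₀ B₁ B₀)
    (hap : ¬ IsPeriodic (A + B)) {a v₀ d : G} (ha : a ∈ A₁) (had : a + d ∈ A)
    (hv₀ : v₀ ∈ B) (hv₀d : v₀ + d ∈ B) (hd : d ≠ 0) (h2d : d + d = 0)
    (hrep : ∀ u ∈ A, ∀ v ∈ B, u + v = a + v₀ → (u = a ∧ v = v₀) ∨ (u = a + d ∧ v = v₀ + d)) :
    v₀ ∉ B₀ := by
  intro hv₀B₀
  have hA₁A : A₁ ⊆ A := h.decomp_left.left_subset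
  have hB₁B : B₁ ⊆ B := h.decomp_right.left_subset
  -- `B₀ ⊆ {v₀, v₀ + d}`
  have hB₀sub : ∀ b ∈ B₀, b = v₀ ∨ b = v₀ + d := by
    intro b hb
    have hl : v₀ - b ∈ L := h.decomp_right.sub_mem v₀ hv₀B₀ b hb
    have hu : (v₀ - b) + a ∈ A := hA₁A (h.decomp_left.periodic.add_mem hl ha)
    rcases hrep _ hu b (h.decomp_right.right_subset hb) (by abel) with ⟨-, e⟩ | ⟨-, e⟩
    · exact Or.inl e
    · exact Or.inr e
  -- `v₀ ∈ B₀` and `v₀ + d ∉ B₁` once `d ∈ L`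
  have key : d ∈ L → False := fun hdL => by
    by_cases hvd : v₀ + d ∈ B₀
    · exact hap (h.isPeriodic_add_of_bottom_subset_pair hdL hd h2d hv₀ hv₀d hB₀sub)
    · have hvd₁ : v₀ + d ∈ B₁ := by
        have : v₀ + d ∈ B₁ ∪ B₀ := by rw [h.decomp_right.union_eq]; exact hv₀d
        exact (mem_union.1 this).resolve_right hvd
      have : -d + (v₀ + d) ∈ B₁ := h.decomp_right.periodic.add_mem (L.neg_mem hdL) hvd₁
      rw [show -d + (v₀ + d) = v₀ by abel] at this
      exact disjoint_left.1 h.decomp_right.disjoint this hv₀B₀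
  by_cases hvd : v₀ + d ∈ B₀
  · exact key (by
      have := h.decomp_right.sub_mem _ hvd _ hv₀B₀
      rwa [add_sub_cancel_left] at this)
  · -- `B₀ = {v₀}`, `v₀ + d ∈ B₁`
    have hvd₁ : v₀ + d ∈ B₁ := by
      have : v₀ + d ∈ B₁ ∪ B₀ := by rw [h.decomp_right.union_eq]; exact hv₀d
      exact (mem_union.1 this).resolve_right hvd
    have hadA : a + d ∈ A₁ ∪ A₀ := by rw [h.decomp_left.union_eq]; exact had
    rcases mem_union.1 hadA with had₁ | had₀
    · -- `a + d ∈ A₁`: every `l ∈ L` gives a representation, so `L ⊆ {0, d}` and `d ∈ L`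
      obtain ⟨l, hlL, hl0⟩ : ∃ l ∈ L, l ≠ (0 : G) := by
        by_contra hno
        push Not at hno
        exact h.decomp_left.ne_bot ((AddSubgroup.eq_bot_iff_forall _).2 hno)
      have hu : l + (a + d) ∈ A := hA₁A (h.decomp_left.periodic.add_mem hlL had₁)
      have hw : -l + (v₀ + d) ∈ B := hB₁B (h.decomp_right.periodic.add_mem (L.neg_mem hlL) hvd₁)
      rcases hrep _ hu _ hw (by rw [show l + (a + d) + (-l + (v₀ + d)) = a + v₀ + (d + d) by abel,
        h2d, add_zero]) with ⟨e, -⟩ | ⟨e, -⟩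
      · -- `e : l + (a + d) = a`, so `l + d = 0` and `l = d ∈ L`
        have hld : l + d = 0 := by
          have : a + (l + d) = a + 0 := by
            rw [add_zero]
            calc a + (l + d) = l + (a + d) := by abel
              _ = a := e
          exact add_left_cancel this
        have hl : l = d := by
          calc l = l + d + d := by rw [add_assoc, h2d, add_zero]
            _ = d := by rw [hld, zero_add]
        exact key (hl ▸ hlL)
      · -- `e : l + (a + d) = a + d`, so `l = 0`
        exact hl0 (add_eq_right.1 e)
    · -- `a + d ∈ A₀ = A₀`: condition (i) for `(a, v₀ + d)` against `(a + d, v₀)`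
      have hq := h.quot_unique a (hA₁A ha) (v₀ + d) hv₀d (a + d) had₀ v₀ hv₀B₀
        (by rw [show a + (v₀ + d) - (a + d + v₀) = (0 : G) by abel]; exact L.zero_mem)
      have hdL : d ∈ L := by
        have := L.neg_mem hq.1
        rwa [show -(a - (a + d)) = d by abel] at this
      exact key hdL

/-- **«`|L/H| = 2` … `L = K`.»**  If `a ∈ A₁`, `v ∈ B₁` (the periodic parts) and `a + v` has only
representations `u + w` with `u ∈ {a, a + d}`, then `L = {0, d}`: each `l ∈ L` gives the representation
`(a + l) + (v − l)`. [cite: Grynkiewicz2009, §6 Claim 5 (p. 26, type (I), «it follows in view of (42)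
that φ_L(a₁) = φ_L(a₂), φ_L(b₁) = φ_L(b₂), and |L/H| = 2 … L = K»)] -/
theorem mem_iff_of_twoReps (h : IsKempermanDecompI L A B A₁ A₀ B₁ B₀) {a v d : G} (ha : a ∈ A₁)
    (hv : v ∈ B₁) (hrep : ∀ u ∈ A, ∀ w ∈ B, u + w = a + v → u = a ∨ u = a + d) :
    ∀ g, g ∈ L ↔ g = 0 ∨ g = d := by
  have hsub : ∀ l ∈ L, l = 0 ∨ l = d := by
    intro l hl
    have hu : l + a ∈ A := h.decomp_left.left_subset (h.decomp_left.periodic.add_mem hl ha)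
    have hw : -l + v ∈ B := h.decomp_right.left_subset (h.decomp_right.periodic.add_mem (L.neg_mem hl) hv)
    rcases hrep _ hu _ hw (by abel) with e | e
    · exact Or.inl (add_eq_right.1 e)
    · exact Or.inr (add_right_cancel (e.trans (add_comm a d)))
  have hdL : d ∈ L := by
    obtain ⟨l, hlL, hl0⟩ : ∃ l ∈ L, l ≠ (0 : G) := by
      by_contra hno
      push Not at hno
      exact h.decomp_left.ne_bot ((AddSubgroup.eq_bot_iff_forall _).2 hno)
    rcases hsub l hlL with e | e
    · exact absurd e hl0
    · rwa [← e]
  intro g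
  constructor
  · exact hsub g
  · rintro (rfl | rfl)
    exacts [L.zero_mem, hdL]

omit [DecidableEq G] in
/-- The (42)-data for all four targets `a + v₀` with `a ∈ {x, x + d}`, `v₀ ∈ {y, y + d}` (`2d = 0`).
[cite: Grynkiewicz2009, §6 Claim 5, display (42)] -/
private theorem rep_of_hK [DecidableEq G] {x y d : G} (h2d : d + d = 0)
    (hK : ∀ u ∈ A, ∀ v ∈ B, (u + v = x + y ∨ u + v = x + y + d) →
      (u = x ∨ u = x + d) ∧ (v = y ∨ v = y + d))
    {a v₀ : G} (ha : a = x ∨ a = x + d) (hv₀ : v₀ = y ∨ v₀ = y + d) :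
    ∀ u ∈ A, ∀ v ∈ B, u + v = a + v₀ → (u = a ∧ v = v₀) ∨ (u = a + d ∧ v = v₀ + d) := by
  intro u hu v hv he
  have hneg : -d = d := by rw [neg_eq_iff_add_eq_zero, h2d]
  have hdd : ∀ z : G, z + d + d = z := fun z => by rw [add_assoc, h2d, add_zero]
  have htarget : u + v = x + y ∨ u + v = x + y + d := by
    rcases ha with rfl | rfl <;> rcases hv₀ with rfl | rfl
    · exact Or.inl he
    · exact Or.inr (by rw [he, add_assoc])
    · exact Or.inr (by rw [he]; abel)
    · exact Or.inl (by rw [he, show x + d + (y + d) = x + y + d + d by abel, hdd])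
  obtain ⟨hu', -⟩ := hK u hu v hv htarget
  -- `u ∈ {a, a + d}` and `v = a + v₀ - u`
  have hv' : v = a + v₀ - u := by rw [← he]; abel
  have hua : u = a ∨ u = a + d := by
    rcases ha with rfl | rfl
    · exact hu'
    · rcases hu' with rfl | rfl
      · exact Or.inr (by rw [hdd])
      · exact Or.inl rfl
  rcases hua with e | e
  · exact Or.inl ⟨e, by rw [hv', e]; abel⟩
  · refine Or.inr ⟨e, ?_⟩
    rw [hv', e, show a + v₀ - (a + d) = v₀ + -d by abel, hneg]

/-- The one-sided case `|A₀| = 1`, `x ∈ A₁`. [cite: Grynkiewicz2009, §6 Claim 5 (p. 26, type (I))] -/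
private theorem structure_of_card_left_eq_one_aux (h : IsKempermanDecompI L A B A₁ A₀ B₁ B₀)
    (hap : ¬ IsPeriodic (A + B)) {x y d : G} (hx₁ : x ∈ A₁) (hxd : x + d ∈ A) (hy : y ∈ B)
    (hyd : y + d ∈ B) (hd : d ≠ 0) (h2d : d + d = 0)
    (hK : ∀ u ∈ A, ∀ v ∈ B, (u + v = x + y ∨ u + v = x + y + d) →
      (u = x ∨ u = x + d) ∧ (v = y ∨ v = y + d))
    (hA1 : #A₀ = 1) :
    ∃ a₀ b₀ : G, A₀ = {a₀} ∧ B₀ = {b₀} ∧ (∀ g, g ∈ L ↔ g = 0 ∨ g = d) ∧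
      x ∈ A₁ ∧ x + d ∈ A₁ ∧ y ∈ B₁ ∧ y + d ∈ B₁ := by
  have hydd : y + d + d = y := by rw [add_assoc, h2d, add_zero]
  -- `y, y + d ∈ B₁`
  have hy₀ : y ∉ B₀ := h.notMem_bottom_of_twoReps hap hx₁ hxd hy hyd hd h2d
    (rep_of_hK h2d hK (Or.inl rfl) (Or.inl rfl))
  have hyd₀ : y + d ∉ B₀ := h.notMem_bottom_of_twoReps hap hx₁ hxd hyd
    (by rw [hydd]; exact hy) hd h2d (rep_of_hK h2d hK (Or.inl rfl) (Or.inr rfl))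
  have hyB : y ∈ B₁ ∪ B₀ := by rw [h.decomp_right.union_eq]; exact hy
  have hy₁ : y ∈ B₁ := (mem_union.1 hyB).resolve_right hy₀
  have hydB : y + d ∈ B₁ ∪ B₀ := by rw [h.decomp_right.union_eq]; exact hyd
  have hyd₁ : y + d ∈ B₁ := (mem_union.1 hydB).resolve_right hyd₀
  -- `L = {0, d}`
  have hL : ∀ g, g ∈ L ↔ g = 0 ∨ g = d :=
    h.mem_iff_of_twoReps hx₁ hy₁ fun u hu w hw e =>
      (hK u hu w hw (Or.inl e)).1
  have hdL : d ∈ L := (hL d).2 (Or.inr rfl)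
  have hxd₁ : x + d ∈ A₁ := by rw [add_comm]; exact h.decomp_left.periodic.add_mem hdL hx₁
  -- `|B₀| = 1`
  obtain ⟨a₀, ha₀⟩ := card_eq_one.1 hA1
  obtain ⟨b₀, hb₀⟩ := h.right_nonempty
  have hb₀B : b₀ ∈ B := h.decomp_right.right_subset hb₀
  have hB₀sub : ∀ b ∈ B₀, b = b₀ ∨ b = b₀ + d := fun b hb => by
    rcases (hL _).1 (h.decomp_right.sub_mem b hb b₀ hb₀) with e | e
    · exact Or.inl (sub_eq_zero.1 e)
    · exact Or.inr (by rw [← e, add_sub_cancel])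
  have hB₀ : B₀ = {b₀} := by
    refine eq_singleton_iff_unique_mem.2 ⟨hb₀, fun b hb => ?_⟩
    rcases hB₀sub b hb with e | e
    · exact e
    · exfalso
      rw [e] at hb
      exact hap (h.isPeriodic_add_of_bottom_subset_pair hdL hd h2d hb₀B
        (h.decomp_right.right_subset hb) hB₀sub)
  exact ⟨a₀, b₀, ha₀, hB₀, hL, hx₁, hxd₁, hy₁, hyd₁⟩

/-- **The structure forced by a type (I) bottom (Claim 5, case `l = 4`).**  For a Kemperman
decomposition (Kemperman's form, quasi-period `L`) of `(A, B)` with `A + B` aperiodic, elements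
`x, x + d ∈ A`, `y, y + d ∈ B` (`d ≠ 0`, `2d = 0`) such that every representation `u + v` (`u ∈ A`,
`v ∈ B`) of `x + y` or of `x + y + d` has `u ∈ {x, x + d}` and `v ∈ {y, y + d}` (display (42)), and a
bottom pair of type (I): `A₀ = {a₀}`, `B₀ = {b₀}`, `L = {0, d}` («`L = K`»), and `x, x + d ∈ A₁`,
`y, y + d ∈ B₁` («`|φ_H(A₀′)| = |φ_H(B₀′)| = 1` … `a₁ ∉ A₀′` and `b₁ ∉ B₀′`»).  W.l.o.g. `|A₀| = 1` by the
symmetry `A ↔ B`; then one of `x, x + d` lies in `A₁` («some `aᵢ`, say `a₂`, is contained in `A₁′`») and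
`structure_of_card_left_eq_one_aux` applies to it. [cite: Grynkiewicz2009, §6 Claim 5 (p. 26,
«Suppose we have type (I) …» up to «Since L = K»)] -/
theorem structure_of_isElementaryI_of_twoReps (h : IsKempermanDecompI L A B A₁ A₀ B₁ B₀)
    (hap : ¬ IsPeriodic (A + B)) {x y d : G} (hx : x ∈ A) (hxd : x + d ∈ A) (hy : y ∈ B)
    (hyd : y + d ∈ B) (hd : d ≠ 0) (h2d : d + d = 0)
    (hK : ∀ u ∈ A, ∀ v ∈ B, (u + v = x + y ∨ u + v = x + y + d) →
      (u = x ∨ u = x + d) ∧ (v = y ∨ v = y + d))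
    (hI : IsElementaryI A₀ B₀) :
    ∃ a₀ b₀ : G, A₀ = {a₀} ∧ B₀ = {b₀} ∧ (∀ g, g ∈ L ↔ g = 0 ∨ g = d) ∧
      x ∈ A₁ ∧ x + d ∈ A₁ ∧ y ∈ B₁ ∧ y + d ∈ B₁ := by
  have hdd : ∀ z : G, z + d + d = z := fun z => by rw [add_assoc, h2d, add_zero]
  -- the (42)-data with `x` replaced by `x + d` (same two targets)
  have hK' : ∀ u ∈ A, ∀ v ∈ B, (u + v = x + d + y ∨ u + v = x + d + y + d) →
      (u = x + d ∨ u = x + d + d) ∧ (v = y ∨ v = y + d) := by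
    intro u hu v hv huv
    have huv' : u + v = x + y ∨ u + v = x + y + d := by
      rcases huv with e | e
      · exact Or.inr (by rw [e]; abel)
      · exact Or.inl (by rw [e, show x + d + y + d = x + y + d + d by abel, hdd])
    obtain ⟨h1, h2⟩ := hK u hu v hv huv'
    refine ⟨?_, h2⟩
    rw [hdd]; exact h1.symm
  -- one-sided version for `|A₀| = 1`, either of `x`, `x + d` in `A₁`
  have left_case : ∀ {A B A₁ A₀ B₁ B₀ : Finset G} {x y : G}, IsKempermanDecompI L A B A₁ A₀ B₁ B₀ →
      ¬ IsPeriodic (A + B) → x ∈ A → x + d ∈ A → y ∈ B → y + d ∈ B →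
      (∀ u ∈ A, ∀ v ∈ B, (u + v = x + y ∨ u + v = x + y + d) →
        (u = x ∨ u = x + d) ∧ (v = y ∨ v = y + d)) →
      (∀ u ∈ A, ∀ v ∈ B, (u + v = x + d + y ∨ u + v = x + d + y + d) →
        (u = x + d ∨ u = x + d + d) ∧ (v = y ∨ v = y + d)) →
      #A₀ = 1 →
      ∃ a₀ b₀ : G, A₀ = {a₀} ∧ B₀ = {b₀} ∧ (∀ g, g ∈ L ↔ g = 0 ∨ g = d) ∧
        x ∈ A₁ ∧ x + d ∈ A₁ ∧ y ∈ B₁ ∧ y + d ∈ B₁ := by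
    intro A B A₁ A₀ B₁ B₀ x y h hap hx hxd hy hyd hK hK' hA1
    by_cases hx₁ : x ∈ A₁
    · exact structure_of_card_left_eq_one_aux h hap hx₁ hxd hy hyd hd h2d hK hA1
    · -- `x ∈ A₀ = {a₀}`, so `x + d ∈ A₁`
      obtain ⟨a₀, ha₀⟩ := card_eq_one.1 hA1
      have hxA : x ∈ A₁ ∪ A₀ := by rw [h.decomp_left.union_eq]; exact hx
      have hx₀ : x ∈ A₀ := (mem_union.1 hxA).resolve_left hx₁
      have hxdA : x + d ∈ A₁ ∪ A₀ := by rw [h.decomp_left.union_eq]; exact hxd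
      have hxd₁ : x + d ∈ A₁ := by
        refine (mem_union.1 hxdA).resolve_right fun hxd₀ => hd ?_
        rw [ha₀, mem_singleton] at hx₀ hxd₀
        rw [← hx₀] at hxd₀
        exact add_eq_left.1 hxd₀
      obtain ⟨a₀', b₀, hA₀, hB₀, hL, h1, h2, h3, h4⟩ :=
        structure_of_card_left_eq_one_aux h hap hxd₁ (by rw [hdd]; exact hx) hy hyd hd h2d hK' hA1
      exact ⟨a₀', b₀, hA₀, hB₀, hL, by rw [hdd] at h2; exact h2, h1, h3, h4⟩
  rcases hI.2.2 with hA1 | hB1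
  · exact left_case h hap hx hxd hy hyd hK hK' hA1
  · -- `|B₀| = 1`: the symmetric decomposition
    have hapBA : ¬ IsPeriodic (B + A) := by rw [add_comm]; exact hap
    have hKs : ∀ v ∈ B, ∀ u ∈ A, (v + u = y + x ∨ v + u = y + x + d) →
        (v = y ∨ v = y + d) ∧ (u = x ∨ u = x + d) := by
      intro v hv u hu hvu
      have : u + v = x + y ∨ u + v = x + y + d := by
        rcases hvu with e | e
        · exact Or.inl (by rw [add_comm, e, add_comm])
        · exact Or.inr (by rw [add_comm, e]; abel)
      exact (hK u hu v hv this).symm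
    have hKs' : ∀ v ∈ B, ∀ u ∈ A, (v + u = y + d + x ∨ v + u = y + d + x + d) →
        (v = y + d ∨ v = y + d + d) ∧ (u = x ∨ u = x + d) := by
      intro v hv u hu hvu
      have : u + v = x + y ∨ u + v = x + y + d := by
        rcases hvu with e | e
        · exact Or.inr (by rw [add_comm, e]; abel)
        · exact Or.inl (by rw [add_comm, e, show y + d + x + d = x + y + d + d by abel, hdd])
      obtain ⟨h1, h2⟩ := hK u hu v hv this
      refine ⟨?_, h1⟩
      rw [hdd]; exact h2.symm
    obtain ⟨b₀, a₀, hB₀, hA₀, hL, h1, h2, h3, h4⟩ :=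
      left_case h.symm hapBA hy hyd hx hxd hKs hKs' hB1
    exact ⟨a₀, b₀, hA₀, hB₀, hL, h3, h4, h1, h2⟩

end IsKempermanDecompI

end Literature.Combinatorics.Additive
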